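import Literature.Combinatorics.SimpleGraph.CycleMatroidRankFunction
import HarnessLib

/-!
# Forest exchange: edge events versus connection events for the spanning forests of a graph

For a finite loop-free edge system `D ⊆ Sym2 V` (a multigraph-free graph on `V`) write
`𝓕(D) = {F ⊆ D : ⟨F⟩ acyclic}` for its spanning forests. For an edge `e = uv ∈ D` the map
`F ↦ F ∖ e` is a bijection

  `{F ∈ 𝓕(D) : e ∈ F} ≃ {F ∈ 𝓕(D) : u ≁_F v}`                                    (∗)

(`u ≁_F v` : `u`, `v` lie in different trees of `F`; such an `F` never contains `e`), and it
commutes with every constraint on the other edges (`card_forests_mem_eq_card_forests_not_reachable`,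
general form with a side condition `X`). Consequences at unit edge weights:

* `#{F : e ∈ F} = #{F : u ≁_F v}` (so for the uniform spanning forest `P(e ∈ F) = P(u ≁_F v)`),
  `#{F : e, f ∈ F} = #{F : u ≁_F v, f ∈ F}`;
* **`negCorr_iff_connEdge`**: the negative-correlation inequality for the pair of edges `e = uv`,
  `f` of the uniform random spanning forest,
  `#{e,f ∈ F} · #𝓕 ≤ #{e ∈ F} · #{f ∈ F}`,
  is EQUIVALENT to the positive correlation of the connection event `u ~_F v` with the edge event
  `f ∈ F`, `#{u ~_F v} · #{f ∈ F} ≤ #{u ~_F v, f ∈ F} · #𝓕`.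

This is the finite (unit-weight) form of the remark «negative correlation for all weights is
equivalent to all connection probabilities being increasing in all weights» for the arboreal gas
(Bauerschmidt–Helmuth, *Spin systems with hyperbolic symmetry: a survey*, §5.2, eq. (5.5); the
negative correlation itself is the open conjecture of Kahn 2000 / Grimmett–Winkler 2004). It is the
bridge used in memo KCLUSTER-gen85 (§2) to show that the two-sided forest-layer conjecture B of the
`NoHeavyLowerTail` programme contains the arboreal-gas negative-correlation conjecture.

Tools: the tree's cycle-matroid rank calculus (`rank_fromEdgeSet_eq_card_iff_isAcyclic`,
`rank_fromEdgeSet_insert_of_(not_)reachable`, Godsil–Royle §15.2). Theorems only; no definitions,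
no `sorry`; the forest families are written as `Finset.filter`s of `D.powerset`.
-/

open Finset SimpleGraph
open scoped Classical
open Literature.Combinatorics.SimpleGraph.TuttePolynomial

namespace Summit.CriticalPhenomena.PercolationContinuityZ3.Theorems.ForestExchange

variable {V : Type*} [Fintype V] [DecidableEq V]

/-! ### §1 Adding an edge to a forest -/

/-- **`⟨F ∪ uv⟩` is a forest iff `⟨F⟩` is a forest and `u ≁_F v`** (for a loop-free `F ∌ uv`,
`u ≠ v`): the one-edge extension is independent in the cycle matroid iff it raises the rank.
[folklore; Godsil–Royle §15.2] -/
theorem isAcyclic_insert_iff {F : Finset (Sym2 V)} (hF : ∀ e ∈ F, ¬e.IsDiag) {u v : V}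
    (huv : u ≠ v) (he : s(u, v) ∉ F) :
    (fromEdgeSet ((insert s(u, v) F : Finset (Sym2 V)) : Set (Sym2 V))).IsAcyclic ↔
      (fromEdgeSet (F : Set (Sym2 V))).IsAcyclic ∧
        ¬(fromEdgeSet (F : Set (Sym2 V))).Reachable u v := by
  have hF' : ∀ e ∈ insert s(u, v) F, ¬e.IsDiag := fun e he' => by
    rcases Finset.mem_insert.1 he' with rfl | he'
    · exact fun h => huv (Sym2.mk_isDiag_iff.1 h)
    · exact hF e he'
  have hcard : #(insert s(u, v) F) = #F + 1 := Finset.card_insert_of_notMem he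
  have hle := rank_fromEdgeSet_le_card F
  rw [← rank_fromEdgeSet_eq_card_iff_isAcyclic hF', ← rank_fromEdgeSet_eq_card_iff_isAcyclic hF,
    hcard]
  by_cases hr : (fromEdgeSet (F : Set (Sym2 V))).Reachable u v
  · rw [rank_fromEdgeSet_insert_of_reachable hr]
    constructor
    · intro h
      omega
    · rintro ⟨_, h⟩
      exact absurd hr h
  · rw [rank_fromEdgeSet_insert_of_not_reachable hr]
    constructor
    · intro h
      exact ⟨by omega, hr⟩
    · rintro ⟨h, _⟩
      omega

omit [Fintype V] [DecidableEq V] in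
/-- A forest containing the edge `uv` joins `u` and `v`; equivalently, if `u ≁_F v` then
`uv ∉ F`. [folklore] -/
theorem not_mem_of_not_reachable {F : Finset (Sym2 V)} {u v : V} (huv : u ≠ v)
    (h : ¬(fromEdgeSet (F : Set (Sym2 V))).Reachable u v) : s(u, v) ∉ F := fun he =>
  h (Adj.reachable ((fromEdgeSet_adj _).2 ⟨Finset.mem_coe.2 he, huv⟩))

/-! ### §2 The exchange bijection `F ↦ F ∖ e` -/

/-- **Forest exchange (general form).** For a loop-free edge system `D`, an edge `e = uv ∈ D`
and ANY side condition `X` on the remaining edges, `F ↦ F ∖ e` is a bijection from the spanning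
forests `F ⊆ D` with `e ∈ F` and `X (F ∖ e)` onto the spanning forests `F ⊆ D` with `u ≁_F v` and
`X F`; in particular the two families are equinumerous. [folklore] -/
theorem card_forests_mem_eq_card_forests_not_reachable (D : Finset (Sym2 V))
    (hD : ∀ e ∈ D, ¬e.IsDiag) {u v : V} (he : s(u, v) ∈ D) (X : Finset (Sym2 V) → Prop)
    [DecidablePred X] :
    #(D.powerset.filter fun F : Finset (Sym2 V) => (fromEdgeSet (F : Set (Sym2 V))).IsAcyclic ∧ s(u, v) ∈ F ∧
        X (F.erase s(u, v))) =
      #(D.powerset.filter fun F : Finset (Sym2 V) => (fromEdgeSet (F : Set (Sym2 V))).IsAcyclic ∧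
        ¬(fromEdgeSet (F : Set (Sym2 V))).Reachable u v ∧ X F) := by
  have huv : u ≠ v := fun h => hD _ he (Sym2.mk_isDiag_iff.2 h)
  refine Finset.card_bij' (fun F _ => F.erase s(u, v)) (fun F _ => insert s(u, v) F)
    ?_ ?_ ?_ ?_
  · intro F hF
    simp only [Finset.mem_filter, Finset.mem_powerset] at hF ⊢
    obtain ⟨hFD, hac, heF, hX⟩ := hF
    have hsub : F.erase s(u, v) ⊆ D := (Finset.erase_subset _ _).trans hFD
    have hF' : ∀ f ∈ F.erase s(u, v), ¬f.IsDiag := fun f hf => hD f (hsub hf)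
    have key := (isAcyclic_insert_iff hF' huv (Finset.notMem_erase _ _)).1
      (by rw [Finset.insert_erase heF]; exact hac)
    exact ⟨hsub, key.1, key.2, hX⟩
  · intro F hF
    simp only [Finset.mem_filter, Finset.mem_powerset] at hF ⊢
    obtain ⟨hFD, hac, hnr, hX⟩ := hF
    have hF' : ∀ f ∈ F, ¬f.IsDiag := fun f hf => hD f (hFD hf)
    have hnot : s(u, v) ∉ F := not_mem_of_not_reachable huv hnr
    refine ⟨Finset.insert_subset he hFD, (isAcyclic_insert_iff hF' huv hnot).2 ⟨hac, hnr⟩,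
      Finset.mem_insert_self _ _, ?_⟩
    rw [Finset.erase_insert hnot]
    exact hX
  · intro F hF
    simp only [Finset.mem_filter] at hF
    exact Finset.insert_erase hF.2.2.1
  · intro F hF
    simp only [Finset.mem_filter] at hF
    exact Finset.erase_insert (not_mem_of_not_reachable huv hF.2.2.1)

/-- **`#{F : e ∈ F} = #{F : u ≁_F v}`** over the spanning forests of `D` (`e = uv ∈ D`): for the
uniform random spanning forest, `P(e ∈ F) = P(u ≁_F v)`. [folklore] -/
theorem card_forests_mem_eq (D : Finset (Sym2 V)) (hD : ∀ e ∈ D, ¬e.IsDiag) {u v : V}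
    (he : s(u, v) ∈ D) :
    #(D.powerset.filter fun F : Finset (Sym2 V) => (fromEdgeSet (F : Set (Sym2 V))).IsAcyclic ∧ s(u, v) ∈ F) =
      #(D.powerset.filter fun F : Finset (Sym2 V) => (fromEdgeSet (F : Set (Sym2 V))).IsAcyclic ∧
        ¬(fromEdgeSet (F : Set (Sym2 V))).Reachable u v) := by
  have h := card_forests_mem_eq_card_forests_not_reachable D hD he (fun _ => True)
  simp only [and_true] at h
  exact h

/-- **`#{F : e, f ∈ F} = #{F : u ≁_F v, f ∈ F}`** over the spanning forests of `D`
(`e = uv ∈ D`, `f ≠ e`). [folklore] -/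
theorem card_forests_mem_mem_eq (D : Finset (Sym2 V)) (hD : ∀ e ∈ D, ¬e.IsDiag) {u v : V}
    (he : s(u, v) ∈ D) {f : Sym2 V} (hf : f ≠ s(u, v)) :
    #(D.powerset.filter fun F : Finset (Sym2 V) => (fromEdgeSet (F : Set (Sym2 V))).IsAcyclic ∧ s(u, v) ∈ F ∧
        f ∈ F) =
      #(D.powerset.filter fun F : Finset (Sym2 V) => (fromEdgeSet (F : Set (Sym2 V))).IsAcyclic ∧
        ¬(fromEdgeSet (F : Set (Sym2 V))).Reachable u v ∧ f ∈ F) := by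
  have h := card_forests_mem_eq_card_forests_not_reachable D hD he (fun F => f ∈ F)
  have hiff : ∀ F : Finset (Sym2 V), f ∈ F.erase s(u, v) ↔ f ∈ F := fun F =>
    ⟨fun hx => Finset.mem_of_mem_erase hx, fun hx => Finset.mem_erase_of_ne_of_mem hf hx⟩
  simp only [hiff] at h
  exact h

/-! ### §3 Negative edge correlation ⟺ positive connection–edge correlation -/

/-- Splitting a forest family by the connection event `u ~_F v`. [folklore] -/
theorem card_filter_reachable_add (S : Finset (Finset (Sym2 V))) (u v : V)
    (Y : Finset (Sym2 V) → Prop) [DecidablePred Y] :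
    #(S.filter fun F : Finset (Sym2 V) => (fromEdgeSet (F : Set (Sym2 V))).Reachable u v ∧ Y F) +
      #(S.filter fun F : Finset (Sym2 V) => ¬(fromEdgeSet (F : Set (Sym2 V))).Reachable u v ∧ Y F) =
        #(S.filter fun F : Finset (Sym2 V) => Y F) := by
  rw [← Finset.card_union_of_disjoint]
  · congr 1
    ext F
    simp only [Finset.mem_union, Finset.mem_filter]
    tauto
  · exact Finset.disjoint_filter.2 fun F _ h1 h2 => h2.1 h1.1

/-- **Negative correlation of two edges ⟺ positive correlation of a connection event with an
edge event (uniform spanning forests, counting form).** For a loop-free edge system `D`, an edge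
`e = uv ∈ D` and an edge `f ≠ e`, writing `N(·)` for numbers of spanning forests `F ⊆ D`:
`N(e ∈ F, f ∈ F) · N ≤ N(e ∈ F) · N(f ∈ F)` iff `N(u ~_F v) · N(f ∈ F) ≤ N(u ~_F v, f ∈ F) · N`.
This is the unit-weight case of «negative correlation for all weights is equivalent to all
connection probabilities being increasing in all weights» for the arboreal gas
(Bauerschmidt–Helmuth survey §5.2). [folklore] -/
theorem negCorr_iff_connEdge (D : Finset (Sym2 V)) (hD : ∀ e ∈ D, ¬e.IsDiag) {u v : V}
    (he : s(u, v) ∈ D) {f : Sym2 V} (hf : f ≠ s(u, v)) :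
    #(D.powerset.filter fun F : Finset (Sym2 V) => (fromEdgeSet (F : Set (Sym2 V))).IsAcyclic ∧ s(u, v) ∈ F ∧
          f ∈ F) *
        #(D.powerset.filter fun F : Finset (Sym2 V) => (fromEdgeSet (F : Set (Sym2 V))).IsAcyclic) ≤
      #(D.powerset.filter fun F : Finset (Sym2 V) => (fromEdgeSet (F : Set (Sym2 V))).IsAcyclic ∧ s(u, v) ∈ F) *
        #(D.powerset.filter fun F : Finset (Sym2 V) => (fromEdgeSet (F : Set (Sym2 V))).IsAcyclic ∧ f ∈ F) ↔
    #(D.powerset.filter fun F : Finset (Sym2 V) => (fromEdgeSet (F : Set (Sym2 V))).IsAcyclic ∧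
          (fromEdgeSet (F : Set (Sym2 V))).Reachable u v) *
        #(D.powerset.filter fun F : Finset (Sym2 V) => (fromEdgeSet (F : Set (Sym2 V))).IsAcyclic ∧ f ∈ F) ≤
      #(D.powerset.filter fun F : Finset (Sym2 V) => (fromEdgeSet (F : Set (Sym2 V))).IsAcyclic ∧
          (fromEdgeSet (F : Set (Sym2 V))).Reachable u v ∧ f ∈ F) *
        #(D.powerset.filter fun F : Finset (Sym2 V) => (fromEdgeSet (F : Set (Sym2 V))).IsAcyclic) := by
  -- the forest family and its four counts
  set S := D.powerset.filter fun F : Finset (Sym2 V) => (fromEdgeSet (F : Set (Sym2 V))).IsAcyclic with hS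
  have hfilt : ∀ (Y : Finset (Sym2 V) → Prop) [DecidablePred Y],
      (D.powerset.filter fun F : Finset (Sym2 V) => (fromEdgeSet (F : Set (Sym2 V))).IsAcyclic ∧ Y F) =
        S.filter fun F : Finset (Sym2 V) => Y F := by
    intro Y _
    rw [hS, Finset.filter_filter]
  rw [card_forests_mem_mem_eq D hD he hf, card_forests_mem_eq D hD he]
  rw [hfilt (fun F => f ∈ F),
    hfilt (fun F : Finset (Sym2 V) => ¬(fromEdgeSet (F : Set (Sym2 V))).Reachable u v ∧ f ∈ F),
    hfilt (fun F : Finset (Sym2 V) => ¬(fromEdgeSet (F : Set (Sym2 V))).Reachable u v),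
    hfilt (fun F : Finset (Sym2 V) => (fromEdgeSet (F : Set (Sym2 V))).Reachable u v),
    hfilt (fun F : Finset (Sym2 V) => (fromEdgeSet (F : Set (Sym2 V))).Reachable u v ∧ f ∈ F)]
  -- `A + R = N` and `Af + Rf = Nf`
  have h1 := card_filter_reachable_add S u v (fun F => f ∈ F)
  have h2 : #(S.filter fun F : Finset (Sym2 V) => (fromEdgeSet (F : Set (Sym2 V))).Reachable u v) +
      #(S.filter fun F : Finset (Sym2 V) => ¬(fromEdgeSet (F : Set (Sym2 V))).Reachable u v) =
        #S :=
    Finset.card_filter_add_card_filter_not _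
  set R := #(S.filter fun F : Finset (Sym2 V) => (fromEdgeSet (F : Set (Sym2 V))).Reachable u v ∧ f ∈ F)
  set A := #(S.filter fun F : Finset (Sym2 V) => ¬(fromEdgeSet (F : Set (Sym2 V))).Reachable u v ∧ f ∈ F)
  set R₀ := #(S.filter fun F : Finset (Sym2 V) => (fromEdgeSet (F : Set (Sym2 V))).Reachable u v)
  set A₀ := #(S.filter fun F : Finset (Sym2 V) => ¬(fromEdgeSet (F : Set (Sym2 V))).Reachable u v)
  set Nf := #(S.filter fun F => f ∈ F)
  set N := #S
  rw [← h1, ← h2]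
  constructor
  · intro h
    nlinarith [h]
  · intro h
    nlinarith [h]

end Summit.CriticalPhenomena.PercolationContinuityZ3.Theorems.ForestExchange
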